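import Literature.AnabelianGeometry.EtaleTheta.Discharge.Sec3Thm37Holds
import Literature.AlgebraicGeometry.Frobenioids.ModelFrobenioidSubQFT
import HarnessLib

/-!
# [EtTh] Theorem 3.7 (i), the tree-vocabulary clauses "isotropic / sub-quasi-Frobenius-trivial /
# not group-like" — UNCONDITIONAL for every tempered Frobenioid (no "`C` is a Frobenioid")

S. Mochizuki, *The étale theta function and its Frobenioid-theoretic manifestations*, Publ. RIMS **45**
(2009), Theorem 3.7 (i), PDF p. 79 [cite: MochizukiEtTh2009, Thm 3.7 p.79]: "… For arbitrary `Λ`, the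
Frobenioid `C` is of isotropic, model [hence, in particular, birationally Frobenius-normalized], and
sub-quasi-Frobenius-trivial type, but not of group-like type" — seat abc-iut-L2-t3's named `Prop`
`TemperedFrobenioid.Thm37_i` (FACT-LIST row **F-0743**; a schema over the free `FrobenioidFacade` for the
[FrdI] Def. 2.8 / 4.5 notions; universal closure refuted by seat abc-iut-f-049).

PROOF-ONLY companion (abc-iut cell, F fact-proving wave FLOAT, seat abc-iut-f-047; unseated tranche 137).
Of the three conjuncts that live in the tree's [FrdI] Def. 1.2 vocabulary, "of isotropic type" and "not
of group-like type" are already unconditional (`thm37_i_isotropic_holds`, `thm37_i_not_groupLike`); "of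
sub-quasi-Frobenius-trivial type" was filed modulo `hF` ("`C → F_Φ` is a Frobenioid", via [FrdI] Prop.
1.10 (vi): `thm37_i_subQuasiFrobeniusTrivial_of_isFrobenioid`). THIS FILE removes `hF`: the tempered
Frobenioid IS the model category `ModelFrobenioid Φ B Div_B`, its `B` is group-like (recorded
`isUnit_BΛ`, `ratFnFunctor_isGroupLike_holds`), and [FrdI] Prop. 1.10 (vi) holds for model categories
with group-like `B` WITHOUT the Frobenioid axioms (`ModelFrobenioid.isOfType_isSubQuasiFrobeniusTrivial`,
seat abc-iut-f-047: every `(X_D, ξ)`, `ξ = of(a) − of(b)`, receives the co-angular pre-step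
`(1, id, a, 0)` from the quasi-Frobenius-trivial object `(X_D, −of(b))`). Hence `thm37_i_treeClauses_holds`:
all three tree-vocabulary clauses of Thm. 3.7 (i), for EVERY inhabitant of the interface, no hypothesis.
No definition; nothing here bears on [IUTchIII] Cor. 3.12; typed ≠ proved elsewhere.
-/

namespace Literature.AnabelianGeometry.EtaleTheta

open CategoryTheory Opposite Literature.AlgebraicGeometry.Frobenioids

universe u₀ v₀ u v w

variable {D₀ : Type u₀} [Category.{v₀} D₀] {V : FrdIMonoidStub.{w}}
  {T : RealifiedDivisorMonoids (D₀ := D₀) V} {D : Type u} [Category.{v} D]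
  {VD : FrdICatStub.{u, v, w} D} (C₀ : TemperedFrobenioid T D VD)

namespace TemperedFrobenioid

/-- **Thm. 3.7 (i), "of sub-quasi-Frobenius-trivial type" — UNCONDITIONAL**: every object of every
tempered Frobenioid is sub-quasi-Frobenius-trivial ([FrdI] Prop. 1.10 (vi) for the model category
`ModelFrobenioid Φ B Div_B` without the Frobenioid axioms, `B` group-like by `isUnit_BΛ`). Supersedes
`thm37_i_subQuasiFrobeniusTrivial_of_isFrobenioid (hF)`. [cite: MochizukiEtTh2009, Thm 3.7 p.79] -/
theorem thm37_i_subQuasiFrobeniusTrivial_holds :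
    PreFrobenioid.IsOfType (PreFrobenioid.IsSubQuasiFrobeniusTrivial C₀.toElem) :=
  ModelFrobenioid.isOfType_isSubQuasiFrobeniusTrivial C₀.ratFnFunctor_isGroupLike_holds

/-- **Thm. 3.7 (i), the three tree-vocabulary clauses — UNCONDITIONAL**: every tempered Frobenioid is "of
isotropic … and sub-quasi-Frobenius-trivial type, but not of group-like type" (the clauses "model /
birationally Frobenius-normalized / unit-profinite / unit-trivial type" of the named `Prop` `Thm37_i` are
slots of the free `FrobenioidFacade` and are not touched). Supersedes `thm37_i_treeClauses_of_isFrobenioid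
(hF)`. [cite: MochizukiEtTh2009, Thm 3.7 p.79] -/
theorem thm37_i_treeClauses_holds :
    PreFrobenioid.IsOfIsotropicType C₀.toElem ∧
      PreFrobenioid.IsOfType (PreFrobenioid.IsSubQuasiFrobeniusTrivial C₀.toElem) ∧
      ¬ PreFrobenioid.IsOfType (PreFrobenioid.IsGroupLikeObj C₀.toElem) :=
  ⟨C₀.thm37_i_isotropic_holds, C₀.thm37_i_subQuasiFrobeniusTrivial_holds, C₀.thm37_i_not_groupLike⟩

end TemperedFrobenioid

end Literature.AnabelianGeometry.EtaleTheta
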